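import Literature.Probability.LatticeModels.LatticeSineGordon
import Summits.QuantumFields.YangMills.Theorems.SmallCircleAnchorAnchorGapStubDebyeScreening

/-!
# Crux `AnchorGap` (stmt-QuantumFields-11141), line `registered` — second soft layer under stub DS′ (`stub_debyeScreening`)

Stub DS′ of the skeleton `Cruxes/AnchorGap/Lines/birth.lean` is Debye screening of the `k`-component
lattice sine-Gordon gas on the discrete three-torus (typed over
`Literature.Probability.LatticeModels.LatticeSineGordon`), in the corrected quantifier order
"`∃ ε₀(N)` after `∀ N`" (the regulator `ε` is removed before the volume limit; the `ε → 0` limit at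
fixed `N` is the neutral gas with compact zero mode).  DS′ itself is expansion-sized (a Brydges 1978 /
Brydges–Federbush type cluster expansion uniform in the period); this file lands the closed,
statement-independent pieces that its proof consumes, complementing the translation layer of
`SmallCircleAnchorAnchorGapStubDebyeScreening.lean`:

* **Sector / zero-mode shift identities** (`φ ↦ φ + w`, `w` a constant vector of the lattice `Λ*`
  dual to the charges, `α_r · w ∈ 2πℤ`): `gaussianAction_add_const` (the gradient term is invariant,
  the regulator produces the linear source `(2g²)⁻¹ ε Σ_p (2 φ_p w + w²)`), `tilt_add_dual` (the
  cosine tilt is `Λ*`-invariant), `weight_add_dual`, `integral_comp_add_const` (Lebesgue measure on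
  configurations is translation invariant), `obs_add_dual` (sitewise `Λ*`-periodicity, clause 4 of the
  admissibility predicate `Obs` of DS′, gives invariance under the GLOBAL shift — induction over the
  finite set of shifted sites), and the resulting exact sector identity
  `integral_mul_weight_sector` / `expect_sector`:
  `⟨F⟩ = ∫ F e^{-(2g²)⁻¹ ε Σ 2φ·w} dμ / ∫ e^{-(2g²)⁻¹ ε Σ 2φ·w} dμ` for `Λ*`-invariant `F` — the
  regulator distinguishes the `Λ*`-sectors of the (non-compact) zero mode exactly by a uniform
  linear source of strength `ε w / g²`, the mechanism behind the corrected quantifier order.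
* **Reduction of DS′ to base point `0` and large separations** (`stub_debyeScreening_of_reduced`):
  it suffices to prove the clustering bound for observables localised in the cube at the origin and
  for separations `n > n₀` (any `n₀` chosen together with `C, c`); the general case follows by
  translation (`obs_translate`, `truncCorr_translate`) and, for `n ≤ n₀`, from
  `|truncCorr| ≤ 2 ≤ 2e^{c n₀} e^{-c n}` (`truncCorr_abs_le_two`), with constant `max C (2 e^{c n₀})`.
-/

set_option autoImplicit false

noncomputable section

namespace Summit.QuantumFields.YangMills.Theorems.AnchorGap

open MeasureTheory
open Literature.Probability.LatticeModels

/-- **The regulator produces a linear source under a constant shift.** For a constant vector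
`w : Fin k → ℝ`, `S_Gauss(φ + w) = S_Gauss(φ) + (2g²)⁻¹ ε Σ_p (2 φ_p w_{p.2} + w_{p.2}²)`: the gradient
term is shift invariant, only the mass term `ε Σ |φ|²` sees the shift. [folklore] -/
theorem gaussianAction_add_const :
    ∀ (d N k : ℕ) [NeZero N] (g ε : ℝ) (w : Fin k → ℝ) (φ : LatticeSineGordon.Config d N k), LatticeSineGordon.gaussianAction g ε (fun p => φ p + w p.2) = LatticeSineGordon.gaussianAction g ε φ + (2 * g ^ 2)⁻¹ * (ε * ∑ p : TorusSite d N × Fin k, (2 * φ p * w p.2 + w p.2 ^ 2)) := by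
  intro d N k _ g ε w φ
  unfold LatticeSineGordon.gaussianAction
  have h1 : ∀ (x : TorusSite d N) (i : Fin d) (a : Fin k),
      (φ (x + Pi.single i 1, a) + w a - (φ (x, a) + w a)) ^ 2 = (φ (x + Pi.single i 1, a) - φ (x, a)) ^ 2 := by
    intro x i a; ring
  have h2 : ∑ p : TorusSite d N × Fin k, (φ p + w p.2) ^ 2 =
      ∑ p : TorusSite d N × Fin k, φ p ^ 2 + ∑ p : TorusSite d N × Fin k, (2 * φ p * w p.2 + w p.2 ^ 2) := by
    rw [← Finset.sum_add_distrib]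
    exact Finset.sum_congr rfl fun p _ => by ring
  simp only [h1, h2]
  ring

/-- **The cosine tilt is invariant under constant shifts by dual-lattice vectors**: if
`α_r · w ∈ 2πℤ` for every charge `r`, then `tilt(φ + w) = tilt(φ)` (`cos (t + z·2π) = cos t`). [folklore] -/
theorem tilt_add_dual :
    ∀ (d N k : ℕ) [NeZero N] (ι : Type) [Fintype ι] (α : ι → Fin k → ℝ) (ζ : ℝ) (w : Fin k → ℝ), (∀ r : ι, ∃ z : ℤ, ∑ a : Fin k, α r a * w a = 2 * Real.pi * z) → ∀ φ : LatticeSineGordon.Config d N k, LatticeSineGordon.tilt α ζ (fun p => φ p + w p.2) = LatticeSineGordon.tilt α ζ φ := by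
  intro d N k _ ι _ α ζ w hw φ
  unfold LatticeSineGordon.tilt
  congr 1
  refine Finset.sum_congr rfl fun x _ => Finset.sum_congr rfl fun r _ => ?_
  obtain ⟨z, hz⟩ := hw r
  have : LatticeSineGordon.pairing (α r) (fun p : TorusSite d N × Fin k => φ p + w p.2) x =
      LatticeSineGordon.pairing (α r) φ x + z * (2 * Real.pi) := by
    unfold LatticeSineGordon.pairing
    rw [mul_comm (z : ℝ), ← hz, ← Finset.sum_add_distrib]
    exact Finset.sum_congr rfl fun a _ => by ring
  rw [this, Real.cos_add_int_mul_two_pi]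

/-- **Boltzmann weight under a constant dual-lattice shift**:
`weight(φ + w) = weight(φ) · exp(-(2g²)⁻¹ ε Σ_p (2 φ_p w_{p.2} + w_{p.2}²))` for `w ∈ Λ*`
(`gaussianAction_add_const` + `tilt_add_dual`). [folklore] -/
theorem weight_add_dual :
    ∀ (d N k : ℕ) [NeZero N] (ι : Type) [Fintype ι] (α : ι → Fin k → ℝ) (g ε ζ : ℝ) (w : Fin k → ℝ), (∀ r : ι, ∃ z : ℤ, ∑ a : Fin k, α r a * w a = 2 * Real.pi * z) → ∀ φ : LatticeSineGordon.Config d N k, LatticeSineGordon.weight α g ε ζ (fun p => φ p + w p.2) = LatticeSineGordon.weight α g ε ζ φ * Real.exp (-((2 * g ^ 2)⁻¹ * (ε * ∑ p : TorusSite d N × Fin k, (2 * φ p * w p.2 + w p.2 ^ 2)))) := by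
  intro d N k _ ι _ α g ε ζ w hw φ
  unfold LatticeSineGordon.weight
  rw [gaussianAction_add_const d N k g ε w φ, tilt_add_dual d N k ι α ζ w hw φ, ← Real.exp_add]
  congr 1
  ring

/-- **Lebesgue measure on configurations is translation invariant in field space**:
`∫ H (φ + u) dφ = ∫ H φ dφ` for every fixed configuration `u` (product Lebesgue measure is an additive
Haar measure; `integral_add_right_eq_self`, no integrability needed). [folklore] -/
theorem integral_comp_add_const :
    ∀ (d N k : ℕ) [NeZero N] (u : LatticeSineGordon.Config d N k) (H : LatticeSineGordon.Config d N k → ℝ), ∫ φ : LatticeSineGordon.Config d N k, H (fun p => φ p + u p) = ∫ φ : LatticeSineGordon.Config d N k, H φ := by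
  intro d N k _ u H
  haveI : (volume : Measure (LatticeSineGordon.Config d N k)).IsAddRightInvariant := by
    rw [volume_pi]; exact Measure.pi.isAddRightInvariant _
  exact integral_add_right_eq_self (μ := (volume : Measure (LatticeSineGordon.Config d N k))) H u

/-- **Sitewise dual-lattice periodicity implies global periodicity.** If `F` is invariant under
shifting the field at any single site by any `w ∈ Λ*` (clause 4 of the admissibility predicate of
DS′), then `F (φ + w) = F φ` for the constant shift by `w ∈ Λ*` at all sites simultaneously
(induction over the finite set of already-shifted sites). [folklore] -/
theorem obs_add_dual :
    ∀ (d N k M : ℕ) [NeZero N] (α : Fin M → Fin k → ℝ) (F : LatticeSineGordon.Config d N k → ℝ), (∀ (φ : LatticeSineGordon.Config d N k) (x : TorusSite d N) (w : Fin k → ℝ), (∀ r : Fin M, ∃ z : ℤ, ∑ a : Fin k, α r a * w a = 2 * Real.pi * z) → F (fun p => if p.1 = x then φ p + w p.2 else φ p) = F φ) → ∀ (φ : LatticeSineGordon.Config d N k) (w : Fin k → ℝ), (∀ r : Fin M, ∃ z : ℤ, ∑ a : Fin k, α r a * w a = 2 * Real.pi * z) → F (fun p => φ p + w p.2) = F φ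 := by
  intro d N k M _ α F hF φ w hw
  classical
  suffices h : ∀ S : Finset (TorusSite d N),
      F (fun p => if p.1 ∈ S then φ p + w p.2 else φ p) = F φ by
    have := h Finset.univ
    simpa only [Finset.mem_univ, if_true] using this
  intro S
  induction S using Finset.induction_on with
  | empty => simp only [Finset.notMem_empty, if_false]
  | insert x S hx ih =>
    have key : (fun p : TorusSite d N × Fin k => if p.1 ∈ insert x S then φ p + w p.2 else φ p) =
        fun p => if p.1 = x then (fun q : TorusSite d N × Fin k => if q.1 ∈ S then φ q + w q.2 else φ q) p + w p.2
          else (fun q : TorusSite d N × Fin k => if q.1 ∈ S then φ q + w q.2 else φ q) p := by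
      funext p
      by_cases hp : p.1 = x
      · rw [if_pos (hp ▸ Finset.mem_insert_self x S), if_pos hp]
        beta_reduce
        rw [if_neg (hp ▸ hx :)]
      · have h1 : (p.1 ∈ insert x S) = (p.1 ∈ S) := by
          rw [Finset.mem_insert, eq_iff_iff, or_iff_right hp]
        simp only [h1, hp, if_false]
    rw [key, hF _ x w hw, ih]

/-- **Exact sector identity (un-normalised).** For `w ∈ Λ*` and an observable `F` invariant under
the constant shift by `w`:
`∫ F · weight = e^{-(2g²)⁻¹ ε Σ_p w_{p.2}²} ∫ F · e^{-(2g²)⁻¹ ε Σ_p 2 φ_p w_{p.2}} · weight`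
— shifting the integration variable by `w` costs exactly the Gaussian prior factor of the sector and a
uniform linear source of strength `ε w / g²` (`weight_add_dual`, `integral_comp_add_const`). [folklore] -/
theorem integral_mul_weight_sector :
    ∀ (d N k : ℕ) [NeZero N] (ι : Type) [Fintype ι] (α : ι → Fin k → ℝ) (g ε ζ : ℝ) (w : Fin k → ℝ), (∀ r : ι, ∃ z : ℤ, ∑ a : Fin k, α r a * w a = 2 * Real.pi * z) → ∀ F : LatticeSineGordon.Config d N k → ℝ, (∀ φ : LatticeSineGordon.Config d N k, F (fun p => φ p + w p.2) = F φ) → ∫ φ : LatticeSineGordon.Config d N k, F φ * LatticeSineGordon.weight α g ε ζ φ = Real.exp (-((2 * g ^ 2)⁻¹ * (ε * ∑ p : TorusSite d N × Fin k, w p.2 ^ 2))) * ∫ φ : LatticeSineGordon.Config d N k, F φ * Real.exp (-((2 * g ^ 2)⁻¹ * (ε * ∑ p : TorusSite d N × Fin k, 2 * φ p * w p.2))) * LatticeSineGordon.weight α g ε ζ φ := by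
  intro d N k _ ι _ α g ε ζ w hw F hF
  rw [← integral_comp_add_const d N k (fun p => w p.2) (fun ψ => F ψ * LatticeSineGordon.weight α g ε ζ ψ),
    ← integral_const_mul]
  refine integral_congr_ae (Filter.Eventually.of_forall fun φ => ?_)
  simp only []
  rw [hF φ, weight_add_dual d N k ι α g ε ζ w hw φ]
  have hsplit : ∑ p : TorusSite d N × Fin k, (2 * φ p * w p.2 + w p.2 ^ 2) =
      ∑ p : TorusSite d N × Fin k, 2 * φ p * w p.2 + ∑ p : TorusSite d N × Fin k, w p.2 ^ 2 :=
    Finset.sum_add_distrib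
  rw [hsplit]
  have : -((2 * g ^ 2)⁻¹ * (ε * (∑ p : TorusSite d N × Fin k, 2 * φ p * w p.2 + ∑ p : TorusSite d N × Fin k, w p.2 ^ 2))) =
      -((2 * g ^ 2)⁻¹ * (ε * ∑ p : TorusSite d N × Fin k, w p.2 ^ 2)) +
        -((2 * g ^ 2)⁻¹ * (ε * ∑ p : TorusSite d N × Fin k, 2 * φ p * w p.2)) := by ring
  rw [this, Real.exp_add]
  ring

/-- **Exact sector identity for expectations.** For `w ∈ Λ*` and `F` invariant under the constant
shift by `w`, `⟨F⟩ = ∫ F e^{-(2g²)⁻¹ ε Σ 2φ·w} weight / ∫ e^{-(2g²)⁻¹ ε Σ 2φ·w} weight`: the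
expectation in "sector `w`" of the non-compact zero mode is the sector-`0` expectation with a uniform
linear source (the prior factor `e^{-(2g²)⁻¹ ε N^d |w|²}` cancels between numerator and partition
function).  This is the identity behind the zero-mode sector floor of the `ε`-uniform statement and
its disappearance as `ε → 0` at fixed `N` (sources `ε w / g² → 0`). [folklore] -/
theorem expect_sector :
    ∀ (d N k : ℕ) [NeZero N] (ι : Type) [Fintype ι] (α : ι → Fin k → ℝ) (g ε ζ : ℝ) (w : Fin k → ℝ), (∀ r : ι, ∃ z : ℤ, ∑ a : Fin k, α r a * w a = 2 * Real.pi * z) → ∀ F : LatticeSineGordon.Config d N k → ℝ, (∀ φ : LatticeSineGordon.Config d N k, F (fun p => φ p + w p.2) = F φ) → LatticeSineGordon.expect α g ε ζ F = (∫ φ : LatticeSineGordon.Config d N k, F φ * Real.exp (-((2 * g ^ 2)⁻¹ * (ε * ∑ p : TorusSite d N × Fin k, 2 * φ p * w p.2))) * LatticeSineGordon.weight α g ε ζ φ) / ∫ φ : LatticeSineGordon.Config d N k, Real.exp (-((2 * g ^ 2)⁻¹ * (ε * ∑ p : TorusSite d N × Fin k, 2 * φ p * w p.2))) * LatticeSineGordon.weight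 α g ε ζ φ := by
  intro d N k _ ι _ α g ε ζ w hw F hF
  unfold LatticeSineGordon.expect LatticeSineGordon.partitionFunction
  have h1 := integral_mul_weight_sector d N k ι α g ε ζ w hw F hF
  have h2 := integral_mul_weight_sector d N k ι α g ε ζ w hw (fun _ => (1 : ℝ)) fun _ => rfl
  simp only [one_mul] at h2
  rw [h1, h2, mul_div_mul_left _ _ (Real.exp_pos _).ne']

/-- **Reduction of DS′ to base point `0` and large separations.** If the Debye-screening bound of
stub `stub_debyeScreening` holds for admissible observables localised in the cube
`{x | ∀ i, (x i).val ≤ R₀}` at the origin and for separations `n > n₀` (with `n₀` chosen together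
with `C, c`, before `N`), then it holds verbatim (all base points `c₀`, all `n` with `2n < N`) with
constants `max C (2 e^{c n₀})` and `c`: translate both observables by `-c₀` (`obs_translate`,
`truncCorr_translate`, `(x + n e₀) - c₀ = (x - c₀) + n e₀`), and for `n ≤ n₀` use
`|truncCorr| ≤ 2 ≤ 2 e^{c n₀} e^{-c n}` (`truncCorr_abs_le_two`; `g ≥ g₁ > 0`, `ε > 0`). [folklore] -/
theorem stub_debyeScreening_of_reduced :
    (∀ (k M : ℕ) (α : Fin M → Fin k → ℝ), (∀ v : Fin k → ℝ, (∀ r : Fin M, ∑ a : Fin k, α r a * v a = 0) → v = 0) → (∃ b : Fin k → Fin k → ℝ, LinearIndependent ℝ b ∧ ∀ (j : Fin k) (r : Fin M), ∃ z : ℤ, ∑ a : Fin k, α r a * b j a = 2 * Real.pi * z) → ∀ g₁ g₂ : ℝ, 0 < g₁ → g₁ ≤ g₂ → ∃ ζ₀ : ℝ, 0 < ζ₀ ∧ ∀ ζ₁ : ℝ, 0 < ζ₁ → ζ₁ ≤ ζ₀ → ∀ R₀ : ℕ, ∃ C c : ℝ, 0 < c ∧ ∃ n₀ : ℕ, ∀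 (N : ℕ) [NeZero N], ∃ ε₀ : ℝ, 0 < ε₀ ∧ ∀ g ζ ε : ℝ, g₁ ≤ g → g ≤ g₂ → ζ₁ ≤ ζ → ζ ≤ ζ₀ → 0 < ε → ε ≤ ε₀ → let Obs := fun F : LatticeSineGordon.Config 3 N k → ℝ => Measurable F ∧ (∀ φ, |F φ| ≤ 1) ∧ (∀ φ ψ : LatticeSineGordon.Config 3 N k, (∀ x : TorusSite 3 N, (∀ i : Fin 3, (x i).val ≤ R₀) → ∀ a : Fin k, φ (x, a) = ψ (x, a)) → F φ = F ψ) ∧ (∀ (φ : LatticeSineGordon.Config 3 N k) (x : TorusSite 3 N) (w : Fin k → ℝ), (∀ r : Fin M, ∃ z : ℤ, ∑ a : Fin k, α r a * w a = 2 * Real.pi * z) → F (fun p => if p.1 = x then φ p + w p.2 else φ p) = F φ); ∀ F G : LatticeSineGordon.Config 3 N k → ℝ, Obs F → Obs G → ∀ n : ℕ, n₀ < n → 2 * n < N → |LatticeSineGordon.truncCorr α g ε ζ F (fun φ => G (fun p => φ (p.1 + Pi.single 0 (n : ZMod N), p.2)))| ≤ C * Real.exp (-(c * n))) → ∀ (k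 M : ℕ) (α : Fin M → Fin k → ℝ), (∀ v : Fin k → ℝ, (∀ r : Fin M, ∑ a : Fin k, α r a * v a = 0) → v = 0) → (∃ b : Fin k → Fin k → ℝ, LinearIndependent ℝ b ∧ ∀ (j : Fin k) (r : Fin M), ∃ z : ℤ, ∑ a : Fin k, α r a * b j a = 2 * Real.pi * z) → ∀ g₁ g₂ : ℝ, 0 < g₁ → g₁ ≤ g₂ → ∃ ζ₀ : ℝ, 0 < ζ₀ ∧ ∀ ζ₁ : ℝ, 0 < ζ₁ → ζ₁ ≤ ζ₀ → ∀ R₀ : ℕ, ∃ C c : ℝ, 0 < c ∧ ∀ (N : ℕ) [NeZero N], ∃ ε₀ : ℝ, 0 < ε₀ ∧ ∀ g ζ ε : ℝ, g₁ ≤ g → g ≤ g₂ → ζ₁ ≤ ζ → ζ ≤ ζ₀ → 0 < ε → ε ≤ ε₀ → ∀ (c₀ : TorusSite 3 N), let Obs := fun F : LatticeSineGordon.Config 3 N k → ℝ => Measurable F ∧ (∀ φ, |F φ| ≤ 1) ∧ (∀ φ ψ : LatticeSineGordon.Config 3 N k, (∀ x : TorusSite 3 N, (∀ i : Fin 3,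 (x i - c₀ i).val ≤ R₀) → ∀ a : Fin k, φ (x, a) = ψ (x, a)) → F φ = F ψ) ∧ (∀ (φ : LatticeSineGordon.Config 3 N k) (x : TorusSite 3 N) (w : Fin k → ℝ), (∀ r : Fin M, ∃ z : ℤ, ∑ a : Fin k, α r a * w a = 2 * Real.pi * z) → F (fun p => if p.1 = x then φ p + w p.2 else φ p) = F φ); ∀ F G : LatticeSineGordon.Config 3 N k → ℝ, Obs F → Obs G → ∀ n : ℕ, 2 * n < N → |LatticeSineGordon.truncCorr α g ε ζ F (fun φ => G (fun p => φ (p.1 + Pi.single 0 (n : ZMod N), p.2)))| ≤ C * Real.exp (-(c * n)) := by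
  intro hred k M α hspan hcomm g₁ g₂ hg₁ hg₁₂
  obtain ⟨ζ₀, hζ₀, hred⟩ := hred k M α hspan hcomm g₁ g₂ hg₁ hg₁₂
  refine ⟨ζ₀, hζ₀, fun ζ₁ hζ₁ hζ₁₀ R₀ => ?_⟩
  obtain ⟨C, c, hc, n₀, hN⟩ := hred ζ₁ hζ₁ hζ₁₀ R₀
  refine ⟨max C (2 * Real.exp (c * n₀)), c, hc, fun N _ => ?_⟩
  obtain ⟨ε₀, hε₀, hmain⟩ := hN N
  refine ⟨ε₀, hε₀, fun g ζ ε hg₁g hgg₂ hζ₁ζ hζζ₀ hε hεε₀ c₀ => ?_⟩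
  intro Obs F G hF hG n h2n
  have hg : g ≠ 0 := (lt_of_lt_of_le hg₁ hg₁g).ne'
  obtain ⟨hFm, hF1, hFloc, hFper⟩ := hF
  obtain ⟨hGm, hG1, hGloc, hGper⟩ := hG
  -- the observables moved to base point `0`
  set v : TorusSite 3 N := -c₀ with hv
  have hc₀v : c₀ + v = 0 := by rw [hv]; exact add_neg_cancel c₀
  have hF' := obs_translate 3 N k M R₀ α c₀ v F ⟨hFm, hF1, hFloc, hFper⟩
  have hG' := obs_translate 3 N k M R₀ α c₀ v G ⟨hGm, hG1, hGloc, hGper⟩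
  rw [hc₀v] at hF' hG'
  have hconv : ∀ H : LatticeSineGordon.Config 3 N k → ℝ,
      (Measurable H ∧ (∀ φ, |H φ| ≤ 1) ∧ (∀ φ ψ : LatticeSineGordon.Config 3 N k, (∀ x : TorusSite 3 N, (∀ i : Fin 3, (x i - (0 : TorusSite 3 N) i).val ≤ R₀) → ∀ a : Fin k, φ (x, a) = ψ (x, a)) → H φ = H ψ) ∧ (∀ (φ : LatticeSineGordon.Config 3 N k) (x : TorusSite 3 N) (w : Fin k → ℝ), (∀ r : Fin M, ∃ z : ℤ, ∑ a : Fin k, α r a * w a = 2 * Real.pi * z) → H (fun p => if p.1 = x then φ p + w p.2 else φ p) = H φ)) →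
      (Measurable H ∧ (∀ φ, |H φ| ≤ 1) ∧ (∀ φ ψ : LatticeSineGordon.Config 3 N k, (∀ x : TorusSite 3 N, (∀ i : Fin 3, (x i).val ≤ R₀) → ∀ a : Fin k, φ (x, a) = ψ (x, a)) → H φ = H ψ) ∧ (∀ (φ : LatticeSineGordon.Config 3 N k) (x : TorusSite 3 N) (w : Fin k → ℝ), (∀ r : Fin M, ∃ z : ℤ, ∑ a : Fin k, α r a * w a = 2 * Real.pi * z) → H (fun p => if p.1 = x then φ p + w p.2 else φ p) = H φ)) := by
    rintro H ⟨h1, h2, h3, h4⟩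
    refine ⟨h1, h2, fun φ ψ h => h3 φ ψ fun x hx => h x fun i => ?_, h4⟩
    simpa only [Pi.zero_apply, sub_zero] using hx i
  have key := hmain g ζ ε hg₁g hgg₂ hζ₁ζ hζζ₀ hε hεε₀ _ _ (hconv _ hF') (hconv _ hG') n
  -- the translated correlation is the original one
  have htr := truncCorr_translate 3 N k (Fin M) α g ε ζ v F
    (fun φ => G (fun p => φ (p.1 + Pi.single 0 (n : ZMod N), p.2)))
  have hfun : (fun φ : LatticeSineGordon.Config 3 N k =>
      (fun ψ : LatticeSineGordon.Config 3 N k => G (fun p => ψ (p.1 + v, p.2)))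
        (fun p => φ (p.1 + Pi.single 0 (n : ZMod N), p.2))) =
      fun φ => (fun ψ : LatticeSineGordon.Config 3 N k => G (fun p => ψ (p.1 + Pi.single 0 (n : ZMod N), p.2)))
        (fun p => φ (p.1 + v, p.2)) := by
    funext φ
    show G _ = G _
    congr 1
    funext p
    show φ _ = φ _
    rw [add_right_comm]
  rw [hfun, htr] at key
  have hexp : 0 < Real.exp (-(c * n)) := Real.exp_pos _
  by_cases hn : n₀ < n
  · calc _ ≤ C * Real.exp (-(c * n)) := key hn h2n
      _ ≤ max C (2 * Real.exp (c * n₀)) * Real.exp (-(c * n)) :=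
          mul_le_mul_of_nonneg_right (le_max_left _ _) hexp.le
  · have hle : n ≤ n₀ := not_lt.1 hn
    have h2 := truncCorr_abs_le_two 3 N k (Fin M) α g ε ζ hg hε F
      (fun φ => G (fun p => φ (p.1 + Pi.single 0 (n : ZMod N), p.2))) hFm
      (measurable_comp_translate 3 N k (Pi.single 0 (n : ZMod N)) G hGm) hF1 (fun φ => hG1 _)
    have hone : 1 ≤ Real.exp (c * n₀) * Real.exp (-(c * n)) := by
      rw [← Real.exp_add]
      refine Real.one_le_exp ?_
      have : (n : ℝ) ≤ n₀ := by exact_mod_cast hle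
      nlinarith
    calc _ ≤ 2 := h2
      _ ≤ 2 * (Real.exp (c * n₀) * Real.exp (-(c * n))) := by linarith
      _ = 2 * Real.exp (c * n₀) * Real.exp (-(c * n)) := by ring
      _ ≤ max C (2 * Real.exp (c * n₀)) * Real.exp (-(c * n)) :=
          mul_le_mul_of_nonneg_right (le_max_right _ _) hexp.le

end Summit.QuantumFields.YangMills.Theorems.AnchorGap

end
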